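/-
Copyright (c) 2026 the pub-hodgecm-mathlib formalisation cell (harness21).  Prover seat hodgecm-mathlib-K2Liu-p07 (g3), Track B «K2-LIT»,
#184♮ = hLiu418 = `stmt-HodgeConjecture-24832`; #42S payer road, organ (σ), OWNER WORD σ19 payer «V7a WITH TAIL», brick T1 (DESIGN-V7aTail §3):
the Bruhat normal form of `w_Δ · n(t)` AT INFINITY (`t` invertible): `w_Δ · n(t) = p(t) · n⁻(t⁻¹)`, `p(t) ∈ P_Δ` with adapted matrix `[[−t⁻¹, 1], [0, t]]`.
-/
import Summits.HodgeConjecture.HodgeConjecture.Theorems.K2LiuLocalSWBigCellDecomposition   -- ★ F3c-A: `adapt_matA_weylDelta` (+ GR Iwahori∕UnramifiedCell API)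
import Summits.HodgeConjecture.HodgeConjecture.Theorems.K2LiuSiegelWeylUnipotentContent    -- ★ `adapt_matA_weylDelta_mul_nElem` (reused, not restated)
import HarnessLib

/-!
# Crux `HLiu418`, #42S organ (σ), «V7a with tail», brick T1: `w_Δ · n(t) = p(t) · n⁻(t⁻¹)` FOR INVERTIBLE SKEW `t`

Cell `hodgecm-mathlib`, crux item hLiu418 = `stmt-HodgeConjecture-24832`; squad K2 ∕ K2Liu; LEAD F0P6-plan (g14), organ lead (σ) K2Liu-p09 (g6);
prover K2Liu-p07 (g3).  THEOREMS ONLY (no `def`, no instance, no notation, no named-fact hypothesis, no `sorry`); lane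
`--supports stmt-HodgeConjecture-24832 --as helper`.

WHY (DESIGN-V7aTail §2 (∞∞)).  The tail of `M_v(s)(f s)(1) = ∫_{N_Δ} f s (w_Δ u) dνN` over the region «`u = n(t)`, `t⁻¹ → 0`» is read off the Bruhat normal form
at infinity: in adapted coordinates `w_Δ = [[0,1],[1,0]]` (★ `adapt_matA_weylDelta`), `n(t) = [[1,t],[0,1]]` (★ `adapt_matA_nElem`), and for invertible `t`
`[[0,1],[1,t]] = [[−t⁻¹, 1],[0, t]] · [[1, 0],[t⁻¹, 1]]` — a `P_Δ`-element times a LOWER Siegel unipotent `n⁻(t⁻¹)` (again in `U(𝔻)(F_v)`: `t⁻¹` is skew when `t` is),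
which tends to `1` as `t⁻¹ → 0`; so `f s (w_Δ n(t)) = χ_s(p(t)) · f s (n⁻(t⁻¹)) = χ_s(p(t)) · φ(1)` eventually (★ T2 `K2LiuFlatFamilyInvariance`).
* `skew_inv` — `t` skew and invertible ⇒ `t⁻¹` skew;  `isUnit_det_lowerUnip`, `cstar_lowerUnip_adForm` — the lower unipotent `[[1,0],[x,1]]` is in `U(𝔻)` for skew `x`;
* (★ `K2LiuSiegelWeylUnipotentContent.adapt_matA_weylDelta_mul_nElem` — `adapt (matA (w_Δ · n(t))) = [[0, 1], [1, t]]`, reused);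
* **`weylDelta_mul_nElem_eq_mul_lowerUnip`** — `w_Δ · n(t) = p · n⁻(t⁻¹)` with `p ∈ P_Δ`, `adapt (matA p) = [[−t⁻¹, 1], [0, t]]` (so `blkA (matA p) = −t⁻¹`, `blkD = t`).
References: [Casselman1980] §3; [Kudla1994] §3; [HarrisKudlaSweet1996] §1 (1.11); [Weil1964] n° 32.
HONEST LABEL.  Count-neutral helper: `HC_CM` is proved only modulo the 7 printed citations (2 remaining named inputs: hLiu418 = `stmt-HodgeConjecture-24832`,
h413 = `stmt-HodgeConjecture-24833`) until rung 0 closes.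
-/

set_option autoImplicit false
set_option linter.dupNamespace false -- the mandated namespace repeats `HodgeConjecture.HodgeConjecture`

noncomputable section

open scoped Matrix
open NumberField IsDedekindDomain Matrix
open Literature.NumberTheory.Automorphic Literature.NumberTheory.Automorphic.UnitaryGroup
open Literature.NumberTheory.GelbartRogawski1991 Literature.NumberTheory.GelbartRogawski1991.AdaptedBlocks
open Literature.NumberTheory.GelbartRogawski1991.UnitaryDualPair.LocalSplitting
open Summit.HodgeConjecture.HodgeConjecture.Cruxes.HLiu418.K2LiuLocalSWBigCellDecomposition
open Summit.HodgeConjecture.HodgeConjecture.Cruxes.HLiu418.K2LiuSiegelWeylUnipotentContent (adapt_matA_weylDelta_mul_nElem)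

namespace Summit.HodgeConjecture.HodgeConjecture.Cruxes.HLiu418.K2LiuSiegelBruhatAtInfinity

variable (F : Type) [Field F] [NumberField F] (E : Type) [Field E] [NumberField E] [Algebra F E] [Algebra.IsQuadraticExtension F E]
  (c : E ≃ₐ[F] E) {δ : E} (hcδ : c δ = -δ) (hδ : δ ≠ 0) {d : F} (hd : δ * δ = algebraMap F E d)
  (v : HeightOneSpectrum (𝓞 F)) (n : ℕ) {T₀ : Matrix (Fin n) (Fin n) F} (hT₀ : T₀.IsSymm)
  {JD : Matrix (Fin (n + n)) (Fin (n + n)) E} (hJD : JD = (gramD F n T₀).map (algebraMap F E))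

/-! ## §1 Skew inverses and lower Siegel unipotents -/

omit [Algebra.IsQuadraticExtension F E] in
/-- **`t⁻¹` is skew when `t` is** (`t` invertible): `(t⁻¹)ᴴ S + S t⁻¹ = (tᴴ)⁻¹ (S t + tᴴ S) t⁻¹ = 0`. [cite: Kudla1994, §3] -/
theorem skew_inv {t : Matrix (Fin n) (Fin n) (LocalRing E v)} (htu : IsUnit t.det)
    (ht : (t.map (conjLocal E c v))ᵀ * gramS F E v n T₀ + gramS F E v n T₀ * t = 0) :
    (t⁻¹.map (conjLocal E c v))ᵀ * gramS F E v n T₀ + gramS F E v n T₀ * t⁻¹ = 0 := by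
  have htu' : IsUnit ((t.map (conjLocal E c v))ᵀ).det := by
    rw [Matrix.det_transpose, ← RingHom.mapMatrix_apply, ← RingHom.map_det]; exact htu.map _
  -- `(t⁻¹)ᴴ = (tᴴ)⁻¹`
  have hinv : (t⁻¹.map (conjLocal E c v))ᵀ = ((t.map (conjLocal E c v))ᵀ)⁻¹ := by
    symm
    apply Matrix.inv_eq_right_inv
    rw [← Matrix.transpose_mul, ← Matrix.map_mul, Matrix.nonsing_inv_mul _ htu, Matrix.map_one _ (map_zero _) (map_one _), Matrix.transpose_one]
  rw [hinv]
  have h1 : gramS F E v n T₀ * t = -((t.map (conjLocal E c v))ᵀ * gramS F E v n T₀) := eq_neg_of_add_eq_zero_right ht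
  have h2 : ((t.map (conjLocal E c v))ᵀ)⁻¹ * gramS F E v n T₀ = -(gramS F E v n T₀ * t⁻¹) := by
    calc ((t.map (conjLocal E c v))ᵀ)⁻¹ * gramS F E v n T₀ = ((t.map (conjLocal E c v))ᵀ)⁻¹ * (gramS F E v n T₀ * t) * t⁻¹ := by
          rw [Matrix.mul_assoc, Matrix.mul_assoc, Matrix.mul_nonsing_inv _ htu, Matrix.mul_one]
      _ = -(gramS F E v n T₀ * t⁻¹) := by
          rw [h1, Matrix.mul_neg, Matrix.neg_mul, ← Matrix.mul_assoc, Matrix.nonsing_inv_mul _ htu', Matrix.one_mul]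
  rw [h2, neg_add_cancel]

omit [NumberField F] [Algebra.IsQuadraticExtension F E] in
/-- `det [[1, 0], [x, 1]] = 1` is a unit. [folklore] -/
theorem isUnit_det_lowerUnip (x : Matrix (Fin n) (Fin n) (LocalRing E v)) : IsUnit (Matrix.fromBlocks (1 : Matrix (Fin n) (Fin n) (LocalRing E v)) 0 x 1).det := by
  rw [Matrix.det_fromBlocks_zero₁₂, Matrix.det_one, mul_one]; exact isUnit_one

omit [Algebra.IsQuadraticExtension F E] in
/-- the lower Siegel unipotent `[[1, 0], [x, 1]]` preserves the adapted form `antidiag(2𝕊, 2𝕊)` for skew `x`. [cite: HarrisKudlaSweet1996, §1 (1.11)] -/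
theorem cstar_lowerUnip_adForm {x : Matrix (Fin n) (Fin n) (LocalRing E v)} (hx : (x.map (conjLocal E c v))ᵀ * gramS F E v n T₀ + gramS F E v n T₀ * x = 0) :
    ((Matrix.fromBlocks (1 : Matrix (Fin n) (Fin n) (LocalRing E v)) 0 x 1).map (conjLocal E c v))ᵀ * adForm F E v n (T₀ := T₀) *
        Matrix.fromBlocks (1 : Matrix (Fin n) (Fin n) (LocalRing E v)) 0 x 1 = adForm F E v n (T₀ := T₀) :=
  cstar_lowerUnip_of_skew (conjLocal E c v) _ (cstar_skew_two_smul hx)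

/-! ## §2 The Bruhat normal form at infinity -/

include hcδ hδ hd hT₀ hJD in
/-- **THE BRUHAT NORMAL FORM AT INFINITY**: for invertible skew `t`, `w_Δ · n(t) = p · n⁻(t⁻¹)` with `p ∈ P_Δ(F_v)` of adapted matrix `[[−t⁻¹, 1], [0, t]]`
and `n⁻(t⁻¹)` the lower Siegel unipotent `[[1, 0], [t⁻¹, 1]]` (in `U(𝔻)(F_v)` by `skew_inv`). [cite: Casselman1980, §3] [cite: Kudla1994, §3] [cite: Weil1964, n° 32] -/
theorem weylDelta_mul_nElem_eq_mul_lowerUnip (t : Matrix (Fin n) (Fin n) (LocalRing E v)) (htu : IsUnit t.det)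
    (ht : (t.map (conjLocal E c v))ᵀ * gramS F E v n T₀ + gramS F E v n T₀ * t = 0) :
    ∃ p : UnitaryGroup.localPi E c (n + n) JD v, IsSiegelDelta F E c hcδ hδ hd v n hT₀ hJD p ∧
      adapt (matA F E c v n p) = Matrix.fromBlocks (-t⁻¹) 1 0 t ∧
      weylDelta F E c v n hJD * nElem F E c v n hJD t ht =
        p * ofAdapted F E c v n hJD (Matrix.fromBlocks 1 0 t⁻¹ 1) (isUnit_det_lowerUnip F E v n t⁻¹)
          (cstar_lowerUnip_adForm F E c v n (skew_inv F E c v n htu ht)) := by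
  set nm := ofAdapted F E c v n hJD (Matrix.fromBlocks 1 0 t⁻¹ 1) (isUnit_det_lowerUnip F E v n t⁻¹)
    (cstar_lowerUnip_adForm F E c v n (skew_inv F E c v n htu ht)) with hnm
  -- the inverse lower unipotent
  set nm' := ofAdapted F E c v n hJD (Matrix.fromBlocks 1 0 (-t⁻¹) 1) (isUnit_det_lowerUnip F E v n (-t⁻¹))
    (cstar_lowerUnip_adForm F E c v n (skew_neg F E c v n (skew_inv F E c v n htu ht))) with hnm'
  have hinv : nm * nm' = 1 := by
    apply matA_injective F E c v n
    rw [← matA_mul, matA_one, hnm, hnm', matA_ofAdapted, matA_ofAdapted]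
    calc cayR _ _ * Matrix.fromBlocks 1 0 t⁻¹ 1 * cayRinv _ _ * (cayR _ _ * Matrix.fromBlocks 1 0 (-t⁻¹) 1 * cayRinv _ _)
        = cayR (LocalRing E v) (Fin n) * (Matrix.fromBlocks 1 0 t⁻¹ 1 * (cayRinv _ _ * cayR _ _) * Matrix.fromBlocks 1 0 (-t⁻¹) 1) *
            cayRinv (LocalRing E v) (Fin n) := by simp only [Matrix.mul_assoc]
      _ = 1 := by
        rw [cayRinv_mul_cayR, Matrix.mul_one, Matrix.fromBlocks_multiply]
        simp only [Matrix.one_mul, Matrix.mul_one, Matrix.zero_mul, Matrix.mul_zero, add_zero, zero_add, Matrix.mul_neg, neg_zero, add_neg_cancel]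
        rw [Matrix.fromBlocks_one, Matrix.mul_one, cayR_mul_cayRinv]
  -- the candidate `p := w_Δ · n(t) · n⁻(t⁻¹)⁻¹` and its adapted matrix
  refine ⟨weylDelta F E c v n hJD * nElem F E c v n hJD t ht * nm', ?_, ?_, ?_⟩
  · have hp : adapt (matA F E c v n (weylDelta F E c v n hJD * nElem F E c v n hJD t ht * nm')) = Matrix.fromBlocks (-t⁻¹) 1 0 t := by
      rw [← matA_mul, adapt_mul, adapt_matA_weylDelta_mul_nElem F E c v n hJD t ht, hnm', adapt_matA_ofAdapted, Matrix.fromBlocks_multiply]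
      simp only [Matrix.zero_mul, Matrix.one_mul, Matrix.mul_one, zero_add, Matrix.mul_neg, Matrix.mul_nonsing_inv _ htu, add_neg_cancel]
    rw [isSiegelDelta_iff_blkC_eq_zero, blkC_eq_toBlocks₂₁_adapt, hp, Matrix.toBlocks_fromBlocks₂₁]
  · rw [← matA_mul, adapt_mul, adapt_matA_weylDelta_mul_nElem F E c v n hJD t ht, hnm', adapt_matA_ofAdapted, Matrix.fromBlocks_multiply]
    simp only [Matrix.zero_mul, Matrix.one_mul, Matrix.mul_one, zero_add, Matrix.mul_neg, Matrix.mul_nonsing_inv _ htu, add_neg_cancel]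
  · have h' : nm' * nm = 1 := by
      rw [mul_eq_one_iff_eq_inv.1 hinv, mul_inv_cancel]
    rw [mul_assoc (weylDelta F E c v n hJD * nElem F E c v n hJD t ht), h', mul_one]

end Summit.HodgeConjecture.HodgeConjecture.Cruxes.HLiu418.K2LiuSiegelBruhatAtInfinity
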